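import Mathlib
import Summits.QuantumFields.BalabanUV.Beta.DecouplingSupport110

/-!
# [Balaban1988RG2Cluster] p. 4: the SUPPORT OF LEMMA 1's TERM `E(□₀, (tζ̃_□ + t_□ζ_□)𝐇_k(H(s), G̃(s), H₀(s)B′))` —
# «the equation reduces … to separate equations in components of Y(σ)»: FIXED POINTS OF BLOCK-SEPARABLE DECORATED
# MAPS ARE IDLE off the block, hence `𝐇_k(s) = H₀(s)B′ + 𝐀₀(s) − H(s)D(s)` of (1.2)∕(1.17) is, hence the term is
# supported on the root component — the sibling's support hypothesis DERIVED for Lemma 1's term in abstract kernel form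
# (cell topic `Summits/QuantumFields/BalabanUV/Beta`; row-D4 terminal leaf (T4)(b), census §10.12 dictionary item (d4))

HONEST FRAMING (cell rule).  Discharging `BetaPertH` makes Bałaban's UV stability UNCONDITIONAL — a real
constructive-QFT result; NOT the continuum limit, NOT the Clay problem.  This module discharges NOTHING of `BetaPertH`.
It completes, in abstract kernel form, the p. 4 paragraph of [II] for the term Lemma 1 is stated on: the sibling
`DecouplingSupport110` (p204556) derived the p. 4 support remark for the PROPAGATORS (block-locality of the `s`-weighted
walk sums) and for the polynomial term shapes T3∕T5∕T6 of `𝐏^{(k)}`; the function `𝐇_k` of (1.2) contains in addition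
the SOLUTIONS `D(H(s), ·)`, `𝐀₀(s)` of the fixed-point equations (1.3), (1.4), about which print says (p. 4) that the
equations SEPARATE over the components of `Y(σ)` and their solutions restricted to a component depend on `s` restricted
to it.  That step — [folklore] uniqueness of fixed points, block by block — is typed here and composed with the sibling's
calculus into the sibling's support hypothesis `SupportedOnRootComp` for Lemma 1's term, so that (1.9) = (1.10)
(`DecouplingResummation110.sum_term19_eq_sum_connected`, p204386) and (1.8) = (1.10)
(`DecouplingExpansion19.eq_sum_term19_connected`, p204558) apply to it BY NAME.  NOT summit progress.  Unit
`b2b-balaban-beta-an4-g34` (owner of `BINDER-OWNERS.md` row D4); cell `GAPS.md` C-an4-69.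

CITATION HEADER (lean-in-tree rule).  [II] = T. Bałaban, *Renormalization group approach to lattice gauge field
theories. II. Cluster expansions*, Commun. Math. Phys. **116**, 1–22 (1988) [Balaban1988RG2Cluster] (journal page =
PDF page; renders `HOME/b2b-balaban-ref1/pages/1988-cmp116-rg-II-cluster/…-p002-x2.png`, `…-p004-x2.png`,
`…-p005-x2.png`, `…-p006-x2.png`, READ AS IMAGES by this unit).  WHAT IS REPRODUCED — p. 2 [PDF 2], verbatim: *"there
exists a function E(X, 𝐔, 𝐉, 𝐀) analytic and localized to X in 𝐔, 𝐉, 𝐀, such that a given term is obtained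
substituting a proper nonlocal expression in the place of 𝐀, e.g., … (tζ̃_□ + t_□ζ_□)𝐇_k(B′) in (I.3.34)"*, (1.2)
`𝐇_k(B′) = H₀B′ + 𝐀₀ − HD(H₀B′ + 𝐀₀)`, *"where the linearizing transformation D(A′) is a solution of the equation"*
(1.3) `D(A′) = C(A′ − HD(A′))`, *"and 𝐀₀ is a solution of the equation"* (1.4) `𝐀₀ + G̃((δ∕δA′)V)(H₀B′ + 𝐀₀) = 0`,
*"Thus Eqs. (1.3), (1.4) are determined by local, analytic functions, and nonlocal propagators H, H₀, G̃."*; p. 4 [PDF 4],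
verbatim: *"Consider Eq. (1.3) with H replaced by H(s). By the above remark this equation reduces to the equality
D(A′) = C(A′) on the neighborhood of Y(σ)ᶜ, and to separate equations in components of Y(σ). The solution D(H(s), A′)
restricted to the interior of a component depends on A′, H(s), hence s, restricted to this component. This implies
that the function (δ∕δA′)V(H(s), A′) has similar properties … Thus Eq. (1.4) represents a system of separated equations
in components of Y(σ). The solution 𝐀₀(H(s), G̃(s), H₀(s)B′) is equal to 0 on the neighborhood of Y(σ)ᶜ, and again, on
a component of Y(σ) it depends on the propagators and B′ restricted to the component."*; p. 5: *"We prove similarly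
that it is contractive on this domain, hence the fixed point is an analytic function of A′, s(Y₀)"* (uniqueness of the
solutions of (1.3), (1.4) in their balls, (1.13)–(1.16)); p. 6 (1.17) = (1.2) with the decorated propagators.

WHAT IS CERTIFIED HERE (kernel, sorry-free; [folklore], in the vocabulary of `DecouplingSupport110`: sites `Λ` in
M-cubes `cube x : Pt d`, parameters `τ : Pt d → ℂ` vanishing off the live family `σ`, `FieldIdle`, `BlockLocal`, `kapply`).
§1 `BlockSeparable cube T σ W` — a decorated self-map `T τ` of the field space SEPARATES over the block `W` ((sep) its
   values at `W`'s sites depend on the argument only at `W`'s sites; (idle) they do not read the parameters of live cubes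
   outside `W`); `WUnique` (the separated equation on `W` has at most one solution); **`fieldIdle_of_fixedPoint`** (a
   family of solutions `T τ (fix τ) = fix τ` of a block-separable, `W`-uniquely-solvable map is IDLE off `W` — the two
   quoted p. 4 sentences); combinators `blockSeparable_id`, `blockSeparable_of_fieldIdle`, `BlockSeparable.localOn_comp`
   (a `W`-LOCAL undecorated operator `C` after a separable map, `LocalOn`), `.comp`, `.pointwise₂`, `.pointwise₁`,
   `blockSeparable_kapply` ∕ `.kapply_comp` (block-local decorated kernels); `wUnique_of_wContraction` (a contraction of
   the sup over `W`'s sites by `q < 1` — `WContraction`, the p. 5 sentence — has at most one `W`-fixed field; finite volume).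
§2 `bHk` = the decorated (1.2)∕(1.17); `fieldIdle_bHk` (idle when `H₀(s)`, `H(s)` are block-local and `𝐀₀(s)`, `D(s)`
   idle); the maps `map13` (`X ↦ C(A′(s) − H(s)X)`, `A′(s) = H₀(s)B′ + 𝐀₀(s)`) and `map14`
   (`A ↦ −G̃(s)·((δ∕δA′)V)(s, H₀(s)B′ + A)`) with `blockSeparable_map13` (from `LocalOn C`, block-local `H(s)`, idle
   `A′(s)`) and `blockSeparable_map14` (from block-local `G̃(s)`, `H₀(s)` and a block-separable decorated gradient
   `(δ∕δA′)V(H(s), ·)` — print's «has similar properties», a HYPOTHESIS here).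
§3 END **`supportedOnRootComp_lemma1Term`**: for `E(□₀, ·)` LOCALIZED in the cubes `R` of `□̃⁴` (`LocalizedIn`; p. 2
   «localized to X») and site scalars `tζ̃_□ + t_□ζ_□`, if for every live family `σ ⊆ σ₀` (with `W = Y₀(σ)` the root
   component) the three decorated propagators are block-local, `C` is local, the gradient separates, and `𝐀₀(s)`, `D(s)`
   solve (1.4), (1.3) with `W`-unique solvability, THEN `SupportedOnRootComp (τ ↦ E(□₀, ζ • 𝐇_k(τ))) R σ₀ a₀`.

NOT CLAIMED (located, by name).  Existence of the fixed points and the contraction property of Bałaban's maps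
([II] (1.13)–(1.16) ∕ [15] Sect. C — tree `B13Contraction113`, `B13Sect1Arith` (1.13)–(1.16) arithmetic); the block-locality
of `H(s)`, `G̃(s)`, `H₀(s)` (the sibling's `blockLocal_walkSum` discharges it for `s`-weighted walk sums; dictionary
(d1)–(d2) of census §10.12); that `C` and `(δ∕δA′)V(H(s), ·)` of [15] (80) have the stated locality∕separability (print:
«local, analytic functions», «has similar properties» — HYPOTHESES `LocalOn`, `BlockSeparable`); analyticity, every BOUND,
the dictionary; NOT summit progress.  MODEL CONVENTIONS: as in the siblings; locality is stated AT the block `W` (print's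
margin «distances to the boundary … bigger than M₁» is absorbed in the choice of `W`); the hypotheses quantify over ALL
complex parameter vectors vanishing off `σ` — for Bałaban's maps, which exist on the closed polydisc `|s(Δ)| ≤ e^{κ₁}`
(p. 5), apply the theorems to the data precomposed with the radial clamp onto that polydisc: the `σ`-terms read the
integrand only there and the clamp commutes with the coordinate moves (sibling `DecouplingResummation110Polydisc`:
`term19_clampVec`, `supportedOnRootComp_clampVec`, and the END with polydisc hypotheses `sum_term19_eq_sum_connected_on`).
-/

namespace Summit.QuantumFields.BalabanUV.Beta.DecouplingSupportFixedPoint110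

open Literature.MathematicalPhysics.QuantumFieldTheory.Balaban1983to89.B14DomainGeom (Pt)
open Literature.MathematicalPhysics.QuantumFieldTheory.Balaban1983to89.B13Factor210 (WallConnected)
open Summit.QuantumFields.BalabanUV.Beta.DecouplingResummation110 (rootComp SupportedOnRootComp subset_rootComp)
open Summit.QuantumFields.BalabanUV.Beta.DecouplingSupport110 (VanishOff BlockLocal FieldIdle ScalarIdle kapply
  fieldIdle_kapply fieldIdle_const supportedOnRootComp_of_scalarIdle)

noncomputable section

variable {d : ℕ} {Λ : Type*} {M : Type*}

/-! ## §1 Decorated self-maps of the field space which SEPARATE over a block -/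

/-- A DECORATED SELF-MAP `T τ : (Λ → M) → (Λ → M)` of the field space (the right-hand sides of the fixed-point equations
(1.3), (1.4) of [II] with the `s`-decorated propagators) SEPARATES OVER THE BLOCK `W` for the live family `σ`:
(sep) its values at the sites of `W` depend on the argument only through its values at the sites of `W` — [II] p. 4:
*"this equation reduces … to separate equations in components of Y(σ)"*; (idle) at a fixed argument, its values at
the sites of `W` do not read the parameters of live cubes outside `W`. [cite: Balaban1988RG2Cluster, p.4 before (1.10)] -/
structure BlockSeparable (cube : Λ → Pt d) (T : (Pt d → ℂ) → (Λ → M) → (Λ → M)) (σ W : Finset (Pt d)) : Prop where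
  sep : ∀ τ, VanishOff σ τ → ∀ D D' : Λ → M, (∀ x, cube x ∈ W → D x = D' x) →
    ∀ x, cube x ∈ W → T τ D x = T τ D' x
  idle : ∀ τ, VanishOff σ τ → ∀ Δ' ∈ σ, Δ' ∉ W → ∀ (z : ℂ) (D : Λ → M) x, cube x ∈ W →
    T (Function.update τ Δ' z) D x = T τ D x

/-- UNIQUE SOLVABILITY OF THE SEPARATED EQUATION on the block `W`: two fields fixed by `T τ` AT THE SITES OF `W` agree
there ([II] p. 5: the fixed points of (1.3), (1.4) are unique in their balls — contractions, (1.13)–(1.16)).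
[cite: Balaban1988RG2Cluster, (1.13)–(1.16) p.5–6] -/
def WUnique (cube : Λ → Pt d) (T : (Pt d → ℂ) → (Λ → M) → (Λ → M)) (σ W : Finset (Pt d)) : Prop :=
  ∀ τ, VanishOff σ τ → ∀ D₁ D₂ : Λ → M, (∀ x, cube x ∈ W → T τ D₁ x = D₁ x) →
    (∀ x, cube x ∈ W → T τ D₂ x = D₂ x) → ∀ x, cube x ∈ W → D₁ x = D₂ x

/-- **FIXED POINTS OF BLOCK-SEPARABLE MAPS ARE IDLE** — [II] p. 4: *"The solution D(H(s), A′) restricted to the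
interior of a component depends on A′, H(s), hence s, restricted to this component"* and *"The solution 𝐀₀(H(s),
G̃(s), H₀(s)B′) … on a component of Y(σ) it depends on the propagators and B′ restricted to the component"*: if
`T` separates over `W`, the separated equation on `W` has at most one solution, and `fix τ` solves `T τ (fix τ) = fix τ`
for every parameter vector vanishing off `σ`, then `fix` is idle off `W`. [cite: Balaban1988RG2Cluster, p.4 before (1.10)] -/
theorem fieldIdle_of_fixedPoint {cube : Λ → Pt d} {T : (Pt d → ℂ) → (Λ → M) → (Λ → M)} {σ W : Finset (Pt d)}
    (hT : BlockSeparable cube T σ W) (hU : WUnique cube T σ W) {fix : (Pt d → ℂ) → Λ → M}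
    (hfix : ∀ τ, VanishOff σ τ → T τ (fix τ) = fix τ) : FieldIdle cube fix σ W := by
  intro τ hτ Δ' hΔ'σ hΔ'W z x hx
  have hτ' : VanishOff σ (Function.update τ Δ' z) := hτ.update hΔ'σ z
  refine hU τ hτ (fix (Function.update τ Δ' z)) (fix τ) ?_ ?_ x hx
  · intro y hy
    rw [← hT.idle τ hτ Δ' hΔ'σ hΔ'W z (fix (Function.update τ Δ' z)) y hy]
    exact congrFun (hfix _ hτ') y
  · intro y _
    exact congrFun (hfix τ hτ) y

/-! ### Building block-separable maps -/

/-- The identity map separates. [folklore] -/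
theorem blockSeparable_id (cube : Λ → Pt d) (σ W : Finset (Pt d)) :
    BlockSeparable cube (fun (_ : Pt d → ℂ) (D : Λ → M) => D) σ W :=
  ⟨fun _ _ _ _ h x hx => h x hx, fun _ _ _ _ _ _ _ _ _ => rfl⟩

/-- A map ignoring its argument and returning an IDLE decorated field separates. [folklore] -/
theorem blockSeparable_of_fieldIdle {cube : Λ → Pt d} {f : (Pt d → ℂ) → Λ → M} {σ W : Finset (Pt d)}
    (hf : FieldIdle cube f σ W) : BlockSeparable cube (fun τ (_ : Λ → M) => f τ) σ W :=
  ⟨fun _ _ _ _ _ _ _ => rfl, fun τ hτ Δ' hΔ'σ hΔ'W z _ x hx => hf τ hτ Δ' hΔ'σ hΔ'W z x hx⟩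

/-- An UNDECORATED operator `C` on fields is LOCAL ON `W`: its values at the sites of `W` depend on the argument only at
the sites of `W` (the local, analytic functions `C`, `V` of (1.3)–(1.4): [II] p. 2 *"Eqs. (1.3), (1.4) are determined
by local, analytic functions, and nonlocal propagators H, H₀, G̃"*; p. 4: *"D(A′) = C(A′) on the neighborhood of
Y(σ)ᶜ"*). [cite: Balaban1988RG2Cluster, p.2 after (1.4)] -/
def LocalOn (cube : Λ → Pt d) (C : (Λ → M) → (Λ → M)) (W : Finset (Pt d)) : Prop :=
  ∀ Φ Φ' : Λ → M, (∀ x, cube x ∈ W → Φ x = Φ' x) → ∀ x, cube x ∈ W → C Φ x = C Φ' x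

/-- A local undecorated operator AFTER a block-separable map separates. [folklore] -/
theorem BlockSeparable.localOn_comp {cube : Λ → Pt d} {T : (Pt d → ℂ) → (Λ → M) → (Λ → M)}
    {σ W : Finset (Pt d)} (hT : BlockSeparable cube T σ W) {C : (Λ → M) → (Λ → M)} (hC : LocalOn cube C W) :
    BlockSeparable cube (fun τ D => C (T τ D)) σ W :=
  ⟨fun τ hτ D D' h x hx => hC _ _ (hT.sep τ hτ D D' h) x hx,
   fun τ hτ Δ' hΔ'σ hΔ'W z D x hx => hC _ _ (fun y hy => hT.idle τ hτ Δ' hΔ'σ hΔ'W z D y hy) x hx⟩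

/-- COMPOSITION of block-separable maps separates. [folklore] -/
theorem BlockSeparable.comp {cube : Λ → Pt d} {T₁ T₂ : (Pt d → ℂ) → (Λ → M) → (Λ → M)} {σ W : Finset (Pt d)}
    (h₂ : BlockSeparable cube T₂ σ W) (h₁ : BlockSeparable cube T₁ σ W) :
    BlockSeparable cube (fun τ D => T₂ τ (T₁ τ D)) σ W := by
  refine ⟨fun τ hτ D D' h x hx => h₂.sep τ hτ _ _ (h₁.sep τ hτ D D' h) x hx, ?_⟩
  intro τ hτ Δ' hΔ'σ hΔ'W z D x hx
  rw [h₂.idle τ hτ Δ' hΔ'σ hΔ'W z (T₁ (Function.update τ Δ' z) D) x hx]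
  exact h₂.sep τ hτ _ _ (fun y hy => h₁.idle τ hτ Δ' hΔ'σ hΔ'W z D y hy) x hx

/-- A POINTWISE binary combination (sum, difference, …) of block-separable maps separates. [folklore] -/
theorem BlockSeparable.pointwise₂ {cube : Λ → Pt d} {σ W : Finset (Pt d)}
    {T₁ : (Pt d → ℂ) → (Λ → M) → (Λ → M)} {T₂ : (Pt d → ℂ) → (Λ → M) → (Λ → M)}
    (h₁ : BlockSeparable cube T₁ σ W) (h₂ : BlockSeparable cube T₂ σ W) (g : M → M → M) :
    BlockSeparable cube (fun τ D x => g (T₁ τ D x) (T₂ τ D x)) σ W :=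
  ⟨fun τ hτ D D' h x hx => by rw [h₁.sep τ hτ D D' h x hx, h₂.sep τ hτ D D' h x hx],
   fun τ hτ Δ' hΔ'σ hΔ'W z D x hx => by
    rw [h₁.idle τ hτ Δ' hΔ'σ hΔ'W z D x hx, h₂.idle τ hτ Δ' hΔ'σ hΔ'W z D x hx]⟩

/-- A POINTWISE unary transform (e.g. `−`) of a block-separable map separates. [folklore] -/
theorem BlockSeparable.pointwise₁ {cube : Λ → Pt d} {σ W : Finset (Pt d)} {T : (Pt d → ℂ) → (Λ → M) → (Λ → M)}
    (h : BlockSeparable cube T σ W) (g : M → M) : BlockSeparable cube (fun τ D x => g (T τ D x)) σ W :=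
  ⟨fun τ hτ D D' hD x hx => by rw [h.sep τ hτ D D' hD x hx],
   fun τ hτ Δ' hΔ'σ hΔ'W z D x hx => by rw [h.idle τ hτ Δ' hΔ'σ hΔ'W z D x hx]⟩

section Linear

variable [Fintype Λ] {𝔸 : Type*} [Semiring 𝔸] [AddCommMonoid M] [Module 𝔸 M]

/-- A BLOCK-LOCAL DECORATED KERNEL applied to the argument separates (rows at the sites of `W` see only the columns in
`W`, and do not read the parameters outside `W`). [folklore] -/
theorem blockSeparable_kapply {cube : Λ → Pt d} {H : (Pt d → ℂ) → Λ → Λ → 𝔸} {σ W : Finset (Pt d)}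
    (hH : BlockLocal cube H σ W) : BlockSeparable cube (fun τ (D : Λ → M) => kapply (H τ) D) σ W := by
  refine ⟨fun τ hτ D D' h x hx => ?_,
    fun τ hτ Δ' hΔ'σ hΔ'W z D x hx => fieldIdle_kapply hH (fieldIdle_const cube D σ W) τ hτ Δ' hΔ'σ hΔ'W z x hx⟩
  unfold kapply
  refine Finset.sum_congr rfl fun y _ => ?_
  by_cases hy : cube y ∈ W
  · rw [h y hy]
  · rw [hH.off τ hτ x y hx hy, zero_smul, zero_smul]

/-- A block-local decorated kernel AFTER a block-separable map separates. [folklore] -/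
theorem BlockSeparable.kapply_comp {cube : Λ → Pt d} {H : (Pt d → ℂ) → Λ → Λ → 𝔸} {σ W : Finset (Pt d)}
    (hH : BlockLocal cube H σ W) {T : (Pt d → ℂ) → (Λ → M) → (Λ → M)} (hT : BlockSeparable cube T σ W) :
    BlockSeparable cube (fun τ D => kapply (H τ) (T τ D)) σ W :=
  (blockSeparable_kapply hH).comp hT

end Linear

/-! ### Unique solvability on the block from a contraction -/

/-- A `W`-CONTRACTION: on arguments compared at the sites of `W`, the map contracts the sup over `W` by a factor
`q < 1` ([II] p. 5: *"We prove similarly that it is contractive on this domain"*). [cite: Balaban1988RG2Cluster, p.5 after (1.13)] -/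
def WContraction [NormedAddCommGroup M] (cube : Λ → Pt d) (T : (Pt d → ℂ) → (Λ → M) → (Λ → M))
    (σ W : Finset (Pt d)) (q : ℝ) : Prop :=
  ∀ τ, VanishOff σ τ → ∀ (D D' : Λ → M) (c : ℝ), (∀ y, cube y ∈ W → ‖D y - D' y‖ ≤ c) →
    ∀ x, cube x ∈ W → ‖T τ D x - T τ D' x‖ ≤ q * c

/-- A `W`-contraction with `q < 1` has at most one `W`-fixed field on `W` (finite volume). [folklore] -/
theorem wUnique_of_wContraction [Fintype Λ] [NormedAddCommGroup M] {cube : Λ → Pt d}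
    {T : (Pt d → ℂ) → (Λ → M) → (Λ → M)} {σ W : Finset (Pt d)} {q : ℝ} (hq : q < 1)
    (hT : WContraction cube T σ W q) : WUnique cube T σ W := by
  classical
  intro τ hτ D₁ D₂ h₁ h₂ x hx
  set S : Finset Λ := Finset.univ.filter fun y => cube y ∈ W with hS
  have hxS : x ∈ S := by simp [hS, hx]
  obtain ⟨x₀, hx₀S, hmax⟩ := Finset.exists_max_image S (fun y => ‖D₁ y - D₂ y‖) ⟨x, hxS⟩
  have hx₀ : cube x₀ ∈ W := by simpa [hS] using hx₀S
  set c := ‖D₁ x₀ - D₂ x₀‖ with hc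
  have hbound : ∀ y, cube y ∈ W → ‖D₁ y - D₂ y‖ ≤ c := fun y hy => hmax y (by simp [hS, hy])
  have hcc : c ≤ q * c := by
    have := hT τ hτ D₁ D₂ c hbound x₀ hx₀
    rwa [h₁ x₀ hx₀, h₂ x₀ hx₀] at this
  have hc0 : c = 0 := by
    have hcnn : 0 ≤ c := norm_nonneg _
    nlinarith
  have := hbound x hx
  rw [hc0] at this
  exact sub_eq_zero.1 (norm_le_zero_iff.1 this)

/-! ## §2 The function `𝐇_k(s)` of (1.2) and the support of Lemma 1's term `E(□₀, (tζ̃_□ + t_□ζ_□)𝐇_k(s, B′))` -/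

section Lemma1Term

variable [Fintype Λ] {𝔸 : Type*} [Semiring 𝔸] [AddCommGroup M] [Module 𝔸 M]

/-- The decorated field (1.2) with `s`-dependent propagators: `𝐇_k(s) = H₀(s)B′ + 𝐀₀(s) − H(s)·D(s)`, where
`𝐀₀(s)` solves (1.4) and `D(s) = D(H(s), H₀(s)B′ + 𝐀₀(s))` solves (1.3) ([II] (1.2) p. 2 ∕ (1.17) p. 6).
[cite: Balaban1988RG2Cluster, (1.2) p.2] -/
def bHk (H₀ H : (Pt d → ℂ) → Λ → Λ → 𝔸) (Bp : Λ → M) (A₀ Dfix : (Pt d → ℂ) → Λ → M) (τ : Pt d → ℂ) :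
    Λ → M :=
  fun x => kapply (H₀ τ) Bp x + A₀ τ x - kapply (H τ) (Dfix τ) x

omit [Fintype Λ] in
/-- A sum of idle fields is idle. [folklore] -/
theorem fieldIdle_add {cube : Λ → Pt d} {f g : (Pt d → ℂ) → Λ → M} {σ W : Finset (Pt d)}
    (hf : FieldIdle cube f σ W) (hg : FieldIdle cube g σ W) :
    FieldIdle cube (fun τ x => f τ x + g τ x) σ W :=
  fun τ hτ Δ' hΔ'σ hΔ'W z x hx => by dsimp only; rw [hf τ hτ Δ' hΔ'σ hΔ'W z x hx, hg τ hτ Δ' hΔ'σ hΔ'W z x hx]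

omit [Fintype Λ] in
/-- A difference of idle fields is idle. [folklore] -/
theorem fieldIdle_sub {cube : Λ → Pt d} {f g : (Pt d → ℂ) → Λ → M} {σ W : Finset (Pt d)}
    (hf : FieldIdle cube f σ W) (hg : FieldIdle cube g σ W) :
    FieldIdle cube (fun τ x => f τ x - g τ x) σ W :=
  fun τ hτ Δ' hΔ'σ hΔ'W z x hx => by dsimp only; rw [hf τ hτ Δ' hΔ'σ hΔ'W z x hx, hg τ hτ Δ' hΔ'σ hΔ'W z x hx]

/-- **`𝐇_k(s)` IS IDLE OFF `W`** when `H₀(s)`, `H(s)` are block-local at `W` and the two fixed points `𝐀₀(s)`, `D(s)`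
are idle off `W` (by `fieldIdle_of_fixedPoint`) — [II] p. 4, the assembled statement for the function (1.2)∕(1.17).
[cite: Balaban1988RG2Cluster, p.4 before (1.10)] -/
theorem fieldIdle_bHk {cube : Λ → Pt d} {H₀ H : (Pt d → ℂ) → Λ → Λ → 𝔸} {σ W : Finset (Pt d)}
    (hH₀ : BlockLocal cube H₀ σ W) (hH : BlockLocal cube H σ W) (Bp : Λ → M) {A₀ Dfix : (Pt d → ℂ) → Λ → M}
    (hA₀ : FieldIdle cube A₀ σ W) (hD : FieldIdle cube Dfix σ W) : FieldIdle cube (bHk H₀ H Bp A₀ Dfix) σ W :=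
  fieldIdle_sub (fieldIdle_add (fieldIdle_kapply hH₀ (fieldIdle_const cube Bp σ W)) hA₀) (fieldIdle_kapply hH hD)

/-- THE MAP OF (1.3) with decorated `H(s)` and decorated argument `A′(s)`: `X ↦ C(A′(s) − H(s)X)` SEPARATES over `W`
when `C` is local on `W`, `H(s)` is block-local at `W` and `A′(s)` is idle off `W`. [cite: Balaban1988RG2Cluster, (1.3) p.2] -/
theorem blockSeparable_map13 {cube : Λ → Pt d} {H : (Pt d → ℂ) → Λ → Λ → 𝔸} {σ W : Finset (Pt d)}
    (hH : BlockLocal cube H σ W) {C : (Λ → M) → (Λ → M)} (hC : LocalOn cube C W) {Ap : (Pt d → ℂ) → Λ → M}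
    (hAp : FieldIdle cube Ap σ W) :
    BlockSeparable cube (fun τ X => C (fun x => Ap τ x - kapply (H τ) X x)) σ W :=
  ((blockSeparable_of_fieldIdle hAp).pointwise₂ (blockSeparable_kapply hH) (· - ·)).localOn_comp hC

/-- THE MAP OF (1.4) with decorated `G̃(s)`, `H₀(s)`: `A ↦ −G̃(s)·((δ∕δA′)V)(s, H₀(s)B′ + A)` SEPARATES over `W` when
`G̃(s)`, `H₀(s)` are block-local at `W` and the decorated gradient `(δ∕δA′)V(H(s), ·)` separates over `W` ([II] p. 4:
*"the function (δ∕δA′)V(H(s), A′) has similar properties"* — a HYPOTHESIS here). [cite: Balaban1988RG2Cluster, (1.4) p.2] -/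
theorem blockSeparable_map14 {cube : Λ → Pt d} {Gt H₀ : (Pt d → ℂ) → Λ → Λ → 𝔸} {σ W : Finset (Pt d)}
    (hGt : BlockLocal cube Gt σ W) (hH₀ : BlockLocal cube H₀ σ W) (Bp : Λ → M)
    {Vg : (Pt d → ℂ) → (Λ → M) → (Λ → M)} (hVg : BlockSeparable cube Vg σ W) :
    BlockSeparable cube (fun τ A => fun x => -(kapply (Gt τ) (Vg τ (fun y => kapply (H₀ τ) Bp y + A y)) x)) σ W :=
  (BlockSeparable.kapply_comp hGt
    (hVg.comp ((blockSeparable_of_fieldIdle (fieldIdle_kapply hH₀ (fieldIdle_const cube Bp σ W))).pointwise₂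
      (blockSeparable_id cube σ W) (· + ·)))).pointwise₁ (fun m => -m)

end Lemma1Term

/-! ## §3 END: the support hypothesis of the sibling's (1.9) = (1.10) for Lemma 1's term -/

section End110

variable [Fintype Λ] {𝔸 : Type*} [Semiring 𝔸] [AddCommGroup M] [Module 𝔸 M] {E : Type*}

/-- A functional of the field LOCALIZED IN `R` ([II] p. 2: *"a function E(X, 𝐔, 𝐉, 𝐀) analytic and localized to X in
𝐔, 𝐉, 𝐀"*, here `X = □₀ ⊂ □̃⁴`): its value depends on the field only at the sites whose cubes lie in `R`.
[cite: Balaban1988RG2Cluster, p.2 before (1.1)] -/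
def LocalizedIn (cube : Λ → Pt d) (Ψ : (Λ → M) → E) (R : Finset (Pt d)) : Prop :=
  ∀ Φ Φ' : Λ → M, (∀ x, cube x ∈ R → Φ x = Φ' x) → Ψ Φ = Ψ Φ'

omit [Fintype Λ] [AddCommGroup M] [Module 𝔸 M] in
/-- A functional localized in `R ⊆ W` evaluated on a field idle off `W` is an idle scalar. [folklore] -/
theorem scalarIdle_of_localizedIn {cube : Λ → Pt d} {Ψ : (Λ → M) → E} {R W σ : Finset (Pt d)}
    (hΨ : LocalizedIn cube Ψ R) (hRW : R ⊆ W) {f : (Pt d → ℂ) → Λ → M} (hf : FieldIdle cube f σ W) :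
    ScalarIdle (fun τ => Ψ (f τ)) σ W :=
  fun τ hτ Δ' hΔ'σ hΔ'W z => hΨ _ _ fun x hx => hf τ hτ Δ' hΔ'σ hΔ'W z x (hRW hx)

omit [Fintype Λ] [AddCommGroup M] [Module 𝔸 M] in
/-- Multiplying an idle field by SITE SCALARS (`tζ̃_□ + t_□ζ_□` of (1.1)) keeps it idle. [folklore] -/
theorem fieldIdle_smul_site {𝕜 : Type*} [SMul 𝕜 M] {cube : Λ → Pt d} (ζ : Λ → 𝕜) {f : (Pt d → ℂ) → Λ → M}
    {σ W : Finset (Pt d)} (hf : FieldIdle cube f σ W) : FieldIdle cube (fun τ x => ζ x • f τ x) σ W :=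
  fun τ hτ Δ' hΔ'σ hΔ'W z x hx => by dsimp only; rw [hf τ hτ Δ' hΔ'σ hΔ'W z x hx]

/-- THE MAP OF (1.4) as a named decorated self-map: `A ↦ −G̃(s)·((δ∕δA′)V)(s, H₀(s)B′ + A)`.
[cite: Balaban1988RG2Cluster, (1.4) p.2] -/
def map14 (Gt H₀ : (Pt d → ℂ) → Λ → Λ → 𝔸) (Bp : Λ → M) (Vg : (Pt d → ℂ) → (Λ → M) → (Λ → M))
    (τ : Pt d → ℂ) (A : Λ → M) : Λ → M :=
  fun x => -(kapply (Gt τ) (Vg τ (fun y => kapply (H₀ τ) Bp y + A y)) x)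

/-- THE MAP OF (1.3) at the decorated argument `A′(s) = H₀(s)B′ + 𝐀₀(s)` as a named decorated self-map:
`X ↦ C(A′(s) − H(s)X)`. [cite: Balaban1988RG2Cluster, (1.3) p.2] -/
def map13 (H₀ H : (Pt d → ℂ) → Λ → Λ → 𝔸) (Bp : Λ → M) (C : (Λ → M) → (Λ → M)) (A₀ : (Pt d → ℂ) → Λ → M)
    (τ : Pt d → ℂ) (X : Λ → M) : Λ → M :=
  C (fun x => (kapply (H₀ τ) Bp x + A₀ τ x) - kapply (H τ) X x)

/-- **SUPPORT OF LEMMA 1's TERM** `E(□₀, (tζ̃_□ + t_□ζ_□)𝐇_k(H(s), G̃(s), H₀(s)B′))` ([II] p. 4, the whole paragraph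
before (1.10), ASSEMBLED): if for every live family `σ ⊆ σ₀`, with `W := Y₀(σ)` the root component, the three decorated
propagators `H₀(s)`, `H(s)`, `G̃(s)` are block-local at `W` (for walk sums: the sibling's `blockLocal_walkSum`), `C` is
local on `W`, the decorated gradient `(δ∕δA′)V(H(s), ·)` separates over `W`, the separated equations (1.4), (1.3) have at
most one solution on `W` (`wUnique_of_wContraction`) and `𝐀₀(s)`, `D(s)` solve them at parameters vanishing off `σ`, and
`E(□₀, ·)` is localized in the cubes `R` of `□̃⁴` (`R` wall-connected ∋ a₀) — then the sibling's support hypothesis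
`SupportedOnRootComp` HOLDS for the term, so that (1.9) = (1.10) and (1.8) = (1.10) follow for it BY NAME
(`DecouplingResummation110.sum_term19_eq_sum_connected`, `DecouplingExpansion19.eq_sum_term19_connected`).
[cite: Balaban1988RG2Cluster, p.4 before (1.10)] -/
theorem supportedOnRootComp_lemma1Term {𝕜 : Type*} [SMul 𝕜 M] (cube : Λ → Pt d) {R σ₀ : Finset (Pt d)}
    {a₀ : Pt d} (hR : WallConnected (↑R : Set (Pt d))) (ha₀ : a₀ ∈ R) {Ψ : (Λ → M) → E}
    (hΨ : LocalizedIn cube Ψ R) (ζ : Λ → 𝕜) {H₀ H Gt : (Pt d → ℂ) → Λ → Λ → 𝔸} (Bp : Λ → M)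
    {C : (Λ → M) → (Λ → M)} {Vg : (Pt d → ℂ) → (Λ → M) → (Λ → M)} {A₀ Dfix : (Pt d → ℂ) → Λ → M}
    (hH₀ : ∀ σ, σ ⊆ σ₀ → BlockLocal cube H₀ σ (rootComp R σ a₀))
    (hH : ∀ σ, σ ⊆ σ₀ → BlockLocal cube H σ (rootComp R σ a₀))
    (hGt : ∀ σ, σ ⊆ σ₀ → BlockLocal cube Gt σ (rootComp R σ a₀))
    (hC : ∀ σ, σ ⊆ σ₀ → LocalOn cube C (rootComp R σ a₀))
    (hVg : ∀ σ, σ ⊆ σ₀ → BlockSeparable cube Vg σ (rootComp R σ a₀))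
    (hA₀u : ∀ σ, σ ⊆ σ₀ → WUnique cube (map14 Gt H₀ Bp Vg) σ (rootComp R σ a₀))
    (hA₀f : ∀ σ, σ ⊆ σ₀ → ∀ τ, VanishOff σ τ → map14 Gt H₀ Bp Vg τ (A₀ τ) = A₀ τ)
    (hDu : ∀ σ, σ ⊆ σ₀ → WUnique cube (map13 H₀ H Bp C A₀) σ (rootComp R σ a₀))
    (hDf : ∀ σ, σ ⊆ σ₀ → ∀ τ, VanishOff σ τ → map13 H₀ H Bp C A₀ τ (Dfix τ) = Dfix τ) :
    SupportedOnRootComp (fun τ => Ψ (fun x => ζ x • bHk H₀ H Bp A₀ Dfix τ x)) R σ₀ a₀ := by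
  refine supportedOnRootComp_of_scalarIdle fun σ hσ => ?_
  have hA₀ : FieldIdle cube A₀ σ (rootComp R σ a₀) :=
    fieldIdle_of_fixedPoint (blockSeparable_map14 (hGt σ hσ) (hH₀ σ hσ) Bp (hVg σ hσ)) (hA₀u σ hσ) (hA₀f σ hσ)
  have hAp : FieldIdle cube (fun τ x => kapply (H₀ τ) Bp x + A₀ τ x) σ (rootComp R σ a₀) :=
    fieldIdle_add (fieldIdle_kapply (hH₀ σ hσ) (fieldIdle_const cube Bp σ _)) hA₀
  have hD : FieldIdle cube Dfix σ (rootComp R σ a₀) :=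
    fieldIdle_of_fixedPoint (blockSeparable_map13 (hH σ hσ) (hC σ hσ) hAp) (hDu σ hσ) (hDf σ hσ)
  exact scalarIdle_of_localizedIn hΨ (subset_rootComp hR ha₀ σ)
    (fieldIdle_smul_site ζ (fieldIdle_bHk (hH₀ σ hσ) (hH σ hσ) Bp hA₀ hD))

end End110

end

end Summit.QuantumFields.BalabanUV.Beta.DecouplingSupportFixedPoint110
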